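import Mathlib
import HarnessLib
import Summits.HubbardSuperconductivity.HubbardSuperconductivity.Theorems.KLProgrammeKLRegimeTwoVolumeLipBlockIdentity
import Summits.HubbardSuperconductivity.HubbardSuperconductivity.Theorems.KLProgrammeKLRegimeEnginePartitionFnUnits
import Summits.HubbardSuperconductivity.HubbardSuperconductivity.Theorems.KLProgrammeKLRegimeWickEffectiveActionLegDressing

/-!
# Route `KLProgramme` — crux K3 ENGINE (stmt-HubbardSuperconductivity-20437), stub (e) proof-input «(e)-D-ROWS», F-D5 first brick: THE SOURCE OF THE
# TWO-VOLUME LIPSCHITZ BLOCK STEP IN TRANSFER FORM — position-space block covariance, block transfer, copies (seat hubbard-kl-k3c4-p1 g23; `--supports` 20437;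
# DROWS-SCOPE-g22 §7.3, §8)

`…TwoVolumeLipBlockIdentity.klLipBornDiff_eq_lip_add_src` splits the born difference of block `k` into the Lipschitz part (the deep block-step door's left side)
and the SOURCE `map g (born_{Γ_k}(map f (klGlue D_L))) − klGlue (klLipBorn L … d k)`, `D_L = klLipInput L … d k`.  This file rewrites the source in the form the
transfer door `…TwoVolumeSubstitutionGluingDeepPin.sum_norm_kernel_map_sub_glue_map_le_of_defect` consumes — `map (toLin' T′) W′ − Glue (map (toLin' T) W)` with a
fine element `W′`, a coarse element `W` and the DEFECT `W′ − Glue W` — by moving the Gaussian step to the POSITION-space labels (`Lit/GrassmannLinearSubstitution.effAction_map`: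
the step at `Γ_k` after the synthesis `S` is the step at the block covariance `C′ := Sᵀ Γ_k S` on the analysed labels, followed by the block transfer
`h := (ε • E(F_{dk})) · S(F̃_{dk−1})` — the shape of route A's `klReanalysis`) and the glued coarse step to the COPIES covariance
(`Lit/GrassmannEffectiveActionCopies.effAction_copies_sum`):

* §1 `map_smul_sectorAnalysis_born_map_sectorSub` (any matrices): `map (toLin' E) (born_C (map (toLin' S) Y)) = map (toLin' (E * S)) (born_{SᵀCS} Y)`;
* §2 one volume: **`klLipBorn_eq_map_transfer_born`** — `klLipBorn V … d k = map (toLin' h_V) (born_{C′_V} (klLipInput V … d k))`;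
  `isUnit_effPartitionFn_lipCov_klLipInput` — `Z(C′_V, klLipInput V … d k)` is a unit when `Z^K_{Λ_{dk}}, Z^K_{Λ_{d(k+1)}} ≠ 0` (slice multiplicativity + plateau);
* §3 two volumes: `klGlue_effAction` (the glued coarse step is the copies step of the glued input), **`lipSource_eq_transfer_form`** — the source equals
  `map (toLin' h_{bL}) W′ − klGlue (map (toLin' h_L) W)` with `W′ := born_{C′_{bL}} (klGlue D_L)`, `W := born_{C′_L} D_L`, and **`lipSourceDefect_eq`** —
  `W′ − klGlue W = effAction C′_{bL} (klGlue D_L) − effAction (klCopiesCov C′_L) (klGlue D_L)`: the COVARIANCE DEFECT of the fine block covariance against the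
  copies of the coarse one at the glued input (near + far parts: route A's `…TwoVolumeBlockDefect*` / `…NearIdentityStep` / `…FarStep` at block indices, F-D5b).

Identities (plus one unit lemma); nothing asserts the (D) rows, stub (e), VL, K3 or superconductivity.  References: BGM 2006 §2.7 (2.70)–(2.71);
Salmhofer 1999 Def. 2.19 (2.102)–(2.106) [cite: BenfattoGiulianiMastropietro2006].
-/

noncomputable section

namespace Summit.HubbardSuperconductivity.HubbardSuperconductivity.Theorems.TwoVolumeLip

set_option linter.dupNamespace false -- summit = problem name (single-conjunct summit), D-0017

open Finset Literature.MathematicalPhysics.QuantumLattice GrassmannAlgebra Literature.Probability.LatticeModels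
open Literature.MathematicalPhysics.QuantumLattice.FermiRG
open Summit.HubbardSuperconductivity.HubbardSuperconductivity.Theorems.KLRegimeSplit
open Summit.HubbardSuperconductivity.HubbardSuperconductivity.Theorems.KLProgrammeLegKernels
open Summit.HubbardSuperconductivity.HubbardSuperconductivity.Theorems.DispersionFlow
open Summit.HubbardSuperconductivity.HubbardSuperconductivity.Theorems.EngineV8
open Summit.HubbardSuperconductivity.HubbardSuperconductivity.Theorems.TwoVolumeSource
open Summit.HubbardSuperconductivity.HubbardSuperconductivity.Theorems.TwoVolumeDefect

/-! ## §1 The born step after a synthesis is the born step at the pulled-back covariance, transferred -/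

section Generic

variable {Γ₀ Γ Γ' : Type*} [Fintype Γ₀] [DecidableEq Γ₀] [Fintype Γ] [DecidableEq Γ]

/-- **`map (toLin' E) (born_C (map (toLin' S) Y)) = map (toLin' (E * S)) (born_{SᵀCS} Y)`** for any matrices `S : Γ₀ × Γ`, `E : Γ′ × Γ₀`, covariance `C` on `Γ₀`
(`effAction_map` + functoriality of `map`). -/
theorem map_born_map_eq_map_mul_born (E : Matrix Γ' Γ₀ ℂ) (S : Matrix Γ₀ Γ ℂ) (C : Matrix Γ₀ Γ₀ ℂ) (Y : GrassmannAlgebra ℂ Γ) :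
    ExteriorAlgebra.map (Matrix.toLin' E)
        (effAction ℂ C (ExteriorAlgebra.map (Matrix.toLin' S) Y) - ExteriorAlgebra.map (Matrix.toLin' S) Y) =
      ExteriorAlgebra.map (Matrix.toLin' (E * S)) (effAction ℂ (S.transpose * C * S) Y - Y) := by
  rw [effAction_map, LinearMap.toMatrix'_toLin', ← map_sub, map_map_eq_map_comp, ← Matrix.toLin'_mul]

end Generic

/-! ## §2 One volume: the born increment is the transferred born step at the position-space block covariance -/

section OneVolume

variable {V M : ℕ} [NeZero V] [NeZero M]

/-- **`klLipBorn V … d k = map (toLin' h_V) (born_{C′_V} (klLipInput V … d k))`** with the block transfer `h_V := (ε • E_V(F_{dk})) · S_V(F̃_{dk−1})` and the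
position-space block covariance `C′_V := S_V(F̃_{dk−1})ᵀ · Γ_k · S_V(F̃_{dk−1})` (`β ≠ 0`, `1 ≤ dk`, `Z^K_{Λ_{dk}} ≠ 0`). [cite: BenfattoGiulianiMastropietro2006, §2.7 (2.70)-(2.71)] -/
theorem klLipBorn_eq_map_transfer_born {β : ℝ} (hβ : β ≠ 0) (U μ : ℝ) (K : TrigPolyC4v) {d k : ℕ} (hdk : 1 ≤ d * k)
    (hZ : hubbardEffPartitionFnCT V M β U μ 0 K (klScale klE0 (d * k)) ≠ 0) :
    klLipBorn V M β U μ K d k =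
      ExteriorAlgebra.map (Matrix.toLin'
          (((((imagTimeWeight β M : ℝ) : ℂ)) • sectorAnalysisMatrix V M β (klAnisoFamily V M β μ K klE0 (d * k))) *
            sectorSubMatrix V M β (bgmFatMultiplier V M klE0 β (nambuXiCT V μ K) (d * k - 1))))
        (effAction ℂ ((sectorSubMatrix V M β (bgmFatMultiplier V M klE0 β (nambuXiCT V μ K) (d * k - 1))).transpose *
              hubbardCovSliceCT V M β μ 0 K (klScale klE0 (d * (k + 1))) (klScale klE0 (d * k)) *
              sectorSubMatrix V M β (bgmFatMultiplier V M klE0 β (nambuXiCT V μ K) (d * k - 1)))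
            (klLipInput V M β U μ K d k) -
          klLipInput V M β U μ K d k) := by
  rw [klLipBorn_eq_map_born hβ U μ K hdk hZ, map_born_map_eq_map_mul_born]

/-- **The block partition function at the position-space covariance is a unit**: `Z(C′_V, klLipInput V … d k) = Z(Γ_k, 𝒱_{dk}) = Z^K_{Λ_{d(k+1)}} / Z^K_{Λ_{dk}}`
(substitution `effPartitionFn_map`, plateau `effPartitionFn_map_sectorSub_sectorPreimage_of_plateau`, slice multiplicativity `hubbardEffPartitionFnCT_eq_mul_slice`). -/
theorem isUnit_effPartitionFn_lipCov_klLipInput {β : ℝ} (hβ : β ≠ 0) (U μ : ℝ) (K : TrigPolyC4v) {d k : ℕ} (hdk : 1 ≤ d * k)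
    (hZ : hubbardEffPartitionFnCT V M β U μ 0 K (klScale klE0 (d * k)) ≠ 0)
    (hZ' : hubbardEffPartitionFnCT V M β U μ 0 K (klScale klE0 (d * (k + 1))) ≠ 0) :
    IsUnit (effPartitionFn ℂ ((sectorSubMatrix V M β (bgmFatMultiplier V M klE0 β (nambuXiCT V μ K) (d * k - 1))).transpose *
          hubbardCovSliceCT V M β μ 0 K (klScale klE0 (d * (k + 1))) (klScale klE0 (d * k)) *
          sectorSubMatrix V M β (bgmFatMultiplier V M klE0 β (nambuXiCT V μ K) (d * k - 1)))
        (klLipInput V M β U μ K d k)) := by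
  have he : (0 : ℝ) < klE0 := by norm_num [klE0]
  have hJ : d * k ≤ d * (k + 1) := Nat.mul_le_mul_left d (Nat.le_succ k)
  have hFF : ∀ ω p, bgmFatMultiplier V M klE0 β (nambuXiCT V μ K) (d * k - 1) ω p * klAnisoFamily V M β μ K klE0 (d * k - 1) ω p =
      klAnisoFamily V M β μ K klE0 (d * k - 1) ω p :=
    fun ω p => bgmFatMultiplier_mul_bgmMultiplier he β (nambuXiCT V μ K) (d * k - 1) ω p
  have hF0 : ∀ p, ∑ ω, klAnisoFamily V M β μ K klE0 (d * k - 1) ω p = 0 → ∀ ω, klAnisoFamily V M β μ K klE0 (d * k - 1) ω p = 0 :=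
    fun p hp ω => klAnisoFamily_eq_zero_of_sum_eq_zero β μ K klE0 (d * k - 1) p hp ω
  have hCpl : ∀ X Y, hubbardCovSliceCT V M β μ 0 K (klScale klE0 (d * (k + 1))) (klScale klE0 (d * k)) X Y ≠ 0 →
      ∑ ω, klAnisoFamily V M β μ K klE0 (d * k - 1) ω X.1.1 = 1 ∧ ∑ ω, klAnisoFamily V M β μ K klE0 (d * k - 1) ω Y.1.1 = 1 :=
    fun X Y h => sum_klAnisoFamily_eq_one_of_blockSliceCT_ne_zero β μ K hdk hJ X Y h
  have hmap := effPartitionFn_map (f := Matrix.toLin' (sectorSubMatrix V M β (bgmFatMultiplier V M klE0 β (nambuXiCT V μ K) (d * k - 1))))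
    (C' := hubbardCovSliceCT V M β μ 0 K (klScale klE0 (d * (k + 1))) (klScale klE0 (d * k))) (V := klLipInput V M β U μ K d k)
  rw [LinearMap.toMatrix'_toLin'] at hmap
  rw [← hmap, klLipInput_def, effPartitionFn_map_sectorSub_sectorPreimage_of_plateau hβ _ _ hFF hF0 _ _ hCpl, isUnit_iff_ne_zero]
  intro h0
  have hmul := hubbardEffPartitionFnCT_eq_mul_slice β U μ 0 K (klScale klE0 (d * (k + 1))) hZ
  unfold klTowerInput klEffectiveAction at h0
  rw [h0, mul_zero] at hmul
  exact hZ' hmul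

end OneVolume

/-! ## §3 Two volumes: the source in transfer form, and its defect as a covariance defect at the glued input -/

section TwoVolumes

variable {L b M : ℕ} [NeZero L] [NeZero (b * L)] [NeZero M]

omit [NeZero M] in
/-- **The glued coarse step is the copies step of the glued input**: for `W` even without constant part and `Z(C′, W)` a unit,
`klGlue (effAction C′ W) = effAction (klCopiesCov C′) (klGlue W)` (`Lit/GrassmannEffectiveActionCopies.effAction_copies_sum`). -/
theorem klGlue_effAction {N : ℕ} (C' : Matrix (SpaceTimeIdx L M × SectorLeg N) (SpaceTimeIdx L M × SectorLeg N) ℂ)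
    {W : GrassmannAlgebra ℂ (SpaceTimeIdx L M × SectorLeg N)} (hWe : W ∈ evenOdd ℂ 0) (hW0 : constPart ℂ W = 0) (hZ : IsUnit (effPartitionFn ℂ C' W)) :
    klGlue L b M N (effAction ℂ C' W) = effAction ℂ (klCopiesCov L b M N C') (klGlue L b M N W) := by
  classical
  have h := (effAction_copies_sum (klBlockEquiv L b M N) C' (klCopiesCov L b M N C') (klCopiesCov_apply C') (klBlockEmb L b M N)
    klBlockEmb_apply hWe hW0 hZ (univ : Finset (Fin 2 → Fin b))).2
  rw [klGlue_def, klGlue_def, h]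

omit [NeZero M] in
/-- The partition function of the glued input at the copies covariance is a unit (same data). -/
theorem isUnit_effPartitionFn_klCopiesCov_klGlue {N : ℕ} (C' : Matrix (SpaceTimeIdx L M × SectorLeg N) (SpaceTimeIdx L M × SectorLeg N) ℂ)
    {W : GrassmannAlgebra ℂ (SpaceTimeIdx L M × SectorLeg N)} (hWe : W ∈ evenOdd ℂ 0) (hW0 : constPart ℂ W = 0) (hZ : IsUnit (effPartitionFn ℂ C' W)) :
    IsUnit (effPartitionFn ℂ (klCopiesCov L b M N C') (klGlue L b M N W)) := by
  classical
  have h := (effAction_copies_sum (klBlockEquiv L b M N) C' (klCopiesCov L b M N C') (klCopiesCov_apply C') (klBlockEmb L b M N)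
    klBlockEmb_apply hWe hW0 hZ (univ : Finset (Fin 2 → Fin b))).1
  rw [klGlue_def]
  exact h

/-- **THE SOURCE IN TRANSFER FORM.**  With the fine volume's block transfer `h_{bL}` and position-space block covariance `C′_{bL}`, the coarse ones `h_L`, `C′_L`,
the coarse input `D_L := klLipInput L … d k` and the glued input `G := klGlue D_L`:
`map g (born_{Γ_k}(map f G)) − klGlue (klLipBorn L … d k) = map (toLin' h_{bL}) (born_{C′_{bL}} G) − klGlue (map (toLin' h_L) (born_{C′_L} D_L))`
(coarse side: `β ≠ 0`, `1 ≤ dk`, `Z^K_{L,Λ_{dk}} ≠ 0`).  This is the left side of the transfer door `…SubstitutionGluingDeepPin.sum_norm_kernel_map_sub_glue_map_le_of_defect`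
at `T′ := h_{bL}`, `T := h_L`, `W′ := born_{C′_{bL}} G`, `W := born_{C′_L} D_L`. -/
theorem lipSource_eq_transfer_form {β : ℝ} (hβ : β ≠ 0) (U μ : ℝ) (K : TrigPolyC4v) {d k : ℕ} (hdk : 1 ≤ d * k)
    (hZc : hubbardEffPartitionFnCT L M β U μ 0 K (klScale klE0 (d * k)) ≠ 0) :
    ExteriorAlgebra.map (Matrix.toLin' ((((imagTimeWeight β M : ℝ) : ℂ)) •
          sectorAnalysisMatrix (b * L) M β (klAnisoFamily (b * L) M β μ K klE0 (d * k))))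
        (effAction ℂ (hubbardCovSliceCT (b * L) M β μ 0 K (klScale klE0 (d * (k + 1))) (klScale klE0 (d * k)))
              (ExteriorAlgebra.map (Matrix.toLin' (sectorSubMatrix (b * L) M β (bgmFatMultiplier (b * L) M klE0 β (nambuXiCT (b * L) μ K) (d * k - 1))))
                (klGlue L b M (sectorCount (d * k - 1)) (klLipInput L M β U μ K d k))) -
            ExteriorAlgebra.map (Matrix.toLin' (sectorSubMatrix (b * L) M β (bgmFatMultiplier (b * L) M klE0 β (nambuXiCT (b * L) μ K) (d * k - 1))))
              (klGlue L b M (sectorCount (d * k - 1)) (klLipInput L M β U μ K d k))) -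
        klGlue L b M (sectorCount (d * k)) (klLipBorn L M β U μ K d k) =
      ExteriorAlgebra.map (Matrix.toLin'
          (((((imagTimeWeight β M : ℝ) : ℂ)) • sectorAnalysisMatrix (b * L) M β (klAnisoFamily (b * L) M β μ K klE0 (d * k))) *
            sectorSubMatrix (b * L) M β (bgmFatMultiplier (b * L) M klE0 β (nambuXiCT (b * L) μ K) (d * k - 1))))
        (effAction ℂ ((sectorSubMatrix (b * L) M β (bgmFatMultiplier (b * L) M klE0 β (nambuXiCT (b * L) μ K) (d * k - 1))).transpose *
              hubbardCovSliceCT (b * L) M β μ 0 K (klScale klE0 (d * (k + 1))) (klScale klE0 (d * k)) *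
              sectorSubMatrix (b * L) M β (bgmFatMultiplier (b * L) M klE0 β (nambuXiCT (b * L) μ K) (d * k - 1)))
            (klGlue L b M (sectorCount (d * k - 1)) (klLipInput L M β U μ K d k)) -
          klGlue L b M (sectorCount (d * k - 1)) (klLipInput L M β U μ K d k)) -
      klGlue L b M (sectorCount (d * k))
        (ExteriorAlgebra.map (Matrix.toLin'
            (((((imagTimeWeight β M : ℝ) : ℂ)) • sectorAnalysisMatrix L M β (klAnisoFamily L M β μ K klE0 (d * k))) *
              sectorSubMatrix L M β (bgmFatMultiplier L M klE0 β (nambuXiCT L μ K) (d * k - 1))))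
          (effAction ℂ ((sectorSubMatrix L M β (bgmFatMultiplier L M klE0 β (nambuXiCT L μ K) (d * k - 1))).transpose *
                hubbardCovSliceCT L M β μ 0 K (klScale klE0 (d * (k + 1))) (klScale klE0 (d * k)) *
                sectorSubMatrix L M β (bgmFatMultiplier L M klE0 β (nambuXiCT L μ K) (d * k - 1)))
              (klLipInput L M β U μ K d k) -
            klLipInput L M β U μ K d k)) := by
  rw [map_born_map_eq_map_mul_born, klLipBorn_eq_map_transfer_born hβ U μ K hdk hZc]

/-- **THE DEFECT OF THE SOURCE IS A COVARIANCE DEFECT AT THE GLUED INPUT.**  With `W′ := born_{C′_{bL}} G`, `W := born_{C′_L} D_L` (`G = klGlue D_L`,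
`D_L = klLipInput L … d k`): `W′ − klGlue W = effAction C′_{bL} G − effAction (klCopiesCov C′_L) G` — the fine block covariance against the COPIES of the coarse
one, at the same glued input (coarse side: `β ≠ 0`, `1 ≤ dk`, `Z^K_{L,Λ_{dk}}, Z^K_{L,Λ_{d(k+1)}} ≠ 0`).  Its near/far split and bounds are F-D5b. -/
theorem lipSourceDefect_eq {β : ℝ} (hβ : β ≠ 0) (U μ : ℝ) (K : TrigPolyC4v) {d k : ℕ} (hdk : 1 ≤ d * k)
    (hZc : hubbardEffPartitionFnCT L M β U μ 0 K (klScale klE0 (d * k)) ≠ 0)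
    (hZc' : hubbardEffPartitionFnCT L M β U μ 0 K (klScale klE0 (d * (k + 1))) ≠ 0) :
    (effAction ℂ ((sectorSubMatrix (b * L) M β (bgmFatMultiplier (b * L) M klE0 β (nambuXiCT (b * L) μ K) (d * k - 1))).transpose *
            hubbardCovSliceCT (b * L) M β μ 0 K (klScale klE0 (d * (k + 1))) (klScale klE0 (d * k)) *
            sectorSubMatrix (b * L) M β (bgmFatMultiplier (b * L) M klE0 β (nambuXiCT (b * L) μ K) (d * k - 1)))
          (klGlue L b M (sectorCount (d * k - 1)) (klLipInput L M β U μ K d k)) -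
        klGlue L b M (sectorCount (d * k - 1)) (klLipInput L M β U μ K d k)) -
      klGlue L b M (sectorCount (d * k - 1))
        (effAction ℂ ((sectorSubMatrix L M β (bgmFatMultiplier L M klE0 β (nambuXiCT L μ K) (d * k - 1))).transpose *
              hubbardCovSliceCT L M β μ 0 K (klScale klE0 (d * (k + 1))) (klScale klE0 (d * k)) *
              sectorSubMatrix L M β (bgmFatMultiplier L M klE0 β (nambuXiCT L μ K) (d * k - 1)))
            (klLipInput L M β U μ K d k) -
          klLipInput L M β U μ K d k) =
      effAction ℂ ((sectorSubMatrix (b * L) M β (bgmFatMultiplier (b * L) M klE0 β (nambuXiCT (b * L) μ K) (d * k - 1))).transpose *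
            hubbardCovSliceCT (b * L) M β μ 0 K (klScale klE0 (d * (k + 1))) (klScale klE0 (d * k)) *
            sectorSubMatrix (b * L) M β (bgmFatMultiplier (b * L) M klE0 β (nambuXiCT (b * L) μ K) (d * k - 1)))
          (klGlue L b M (sectorCount (d * k - 1)) (klLipInput L M β U μ K d k)) -
        effAction ℂ (klCopiesCov L b M (sectorCount (d * k - 1))
            ((sectorSubMatrix L M β (bgmFatMultiplier L M klE0 β (nambuXiCT L μ K) (d * k - 1))).transpose *
              hubbardCovSliceCT L M β μ 0 K (klScale klE0 (d * (k + 1))) (klScale klE0 (d * k)) *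
              sectorSubMatrix L M β (bgmFatMultiplier L M klE0 β (nambuXiCT L μ K) (d * k - 1))))
          (klGlue L b M (sectorCount (d * k - 1)) (klLipInput L M β U μ K d k)) := by
  have hDe : klLipInput L M β U μ K d k ∈ evenOdd ℂ 0 :=
    klLipInput_mem_evenOdd_zero (Summit.HubbardSuperconductivity.HubbardSuperconductivity.Theorems.KLRegimeWick.klEffectiveAction_mem_evenOdd_zero β U μ K klE0 (d * k))
  have hD0 : constPart ℂ (klLipInput L M β U μ K d k) = 0 := by
    rw [constPart_klLipInput]
    exact constPart_klEffectiveAction_eq_zero β U μ K klE0 (d * k) hZc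
  have hZu := isUnit_effPartitionFn_lipCov_klLipInput (V := L) hβ U μ K hdk hZc hZc'
  rw [klGlue_sub, klGlue_effAction _ hDe hD0 hZu]
  abel

end TwoVolumes

end Summit.HubbardSuperconductivity.HubbardSuperconductivity.Theorems.TwoVolumeLip

end
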